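import Mathlib.Analysis.Convex.SpecificFunctions.Basic
import Literature.NumberTheory.LFunctions.ZetaScrew
import HarnessLib

/-!
# The smooth part of Suzuki's `Ψ` on quartic cells (stub `stub_smoothPartQuarticDefect` of crux
`SparseScrewLandau.QuarticSampleLandau`, stmt-RiemannHypothesis-23405)

Route `SparseScrewLandau` (L41 «sparse screw Landau»), line «quartic chord», registered stub 2.
Write `G := Ψ + φ = zetaScrew + zetaScrewPrimeSum` (the prime sum removed).  By `zetaScrew_eq`
(Suzuki 2023, arXiv:2206.03682, (1.1)), for `t ≥ 0`,
`G(t) = 4 e^{t/2} + 4 e^{-t/2} - 8 - (t/2) c₀ + ¼ C - ¼ e^{-t/2} Φ(e^{-2t}, 2, ¼)`,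
`c₀ = γ + π/2 + 3 log 2 + log π`, `C = ζ(2, ¼)`.  On the quartic cell `[a, b] = [4 log n, 4 log (n+1)]`
containing `t = s a + (1-s) b`:
* the affine part is reproduced exactly by the chord;
* `e^{-t/2} Φ(e^{-2t},2,¼) = ∑_k e^{-(2k+½)t} (k+¼)^{-2}` is a positive mixture of exponentials, hence
  convex, so `-¼(…)` lies ABOVE its chord (`exp_neg_mul_hurwitzLerchQuarter_convexCombo`);
* the two exponentials are convex with chord defect at most `s(1-s)(y-x)(e^y-e^x)` (the elementary
  `exp_chord_defect`, from `e^u ≥ 1 + u` only): with `e^{a/2} = n²`, `e^{b/2} = (n+1)²`,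
  `b/2 - a/2 = 2 log(1+1/n) ≤ 2/n` this is `≤ 3/2` for `4e^{t/2}`'s kernel and `≤ 1/2` for `4e^{-t/2}`'s.
Hence `s G(a) + (1-s) G(b) - 8 ≤ G(t)`: the stub holds with `D = 8` (numerically the sharp constant is
`4.80…`, attained on the first cell).  No interval arithmetic, no zeros of `ζ`, no primes beyond the
definition of `φ`.

RH is not proved by this file; nothing here bears on the truth of RH.
-/

-- `Summit.RiemannHypothesis.RiemannHypothesis.…` repeats a component by the tree's layout (D-0017).
set_option linter.dupNamespace false

noncomputable section

namespace Summit.RiemannHypothesis.RiemannHypothesis.Theorems.SparseScrewLandau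

open Literature.NumberTheory.LFunctions

/-! ## Elementary convexity facts for `exp` -/

/-- **Chord defect of the exponential.** For real `x, y` and `s ∈ [0,1]`,
`s e^x + (1-s) e^y - e^{s x + (1-s) y} ≤ s (1-s) (y - x) (e^y - e^x)`.
(With `m = s x + (1-s) y`, `L = y - x`: `e^y - e^m = e^m (e^{sL} - 1) ≤ sL e^y` and
`e^m - e^x = e^x (e^{(1-s)L} - 1) ≥ (1-s) L e^x`, both from `e^u ≥ 1 + u`.) -/
theorem exp_chord_defect (x y : ℝ) {s : ℝ} (hs0 : 0 ≤ s) (hs1 : s ≤ 1) :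
    s * Real.exp x + (1 - s) * Real.exp y - Real.exp (s * x + (1 - s) * y)
      ≤ s * (1 - s) * (y - x) * (Real.exp y - Real.exp x) := by
  have h1s : 0 ≤ 1 - s := sub_nonneg.2 hs1
  have hy : Real.exp y = Real.exp (s * x + (1 - s) * y) * Real.exp (s * (y - x)) := by
    rw [← Real.exp_add]; congr 1; ring
  have hm : Real.exp (s * x + (1 - s) * y) = Real.exp x * Real.exp ((1 - s) * (y - x)) := by
    rw [← Real.exp_add]; congr 1; ring
  -- `e^u - 1 ≤ u e^u` (i.e. `1 - u ≤ e^{-u}`; also `Literature.…AreaLaw.exp_sub_one_le_mul_exp`)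
  have h1 : Real.exp (s * (y - x)) - 1 ≤ s * (y - x) * Real.exp (s * (y - x)) := by
    have h := Real.add_one_le_exp (-(s * (y - x)))
    have hmul : (-(s * (y - x)) + 1) * Real.exp (s * (y - x)) ≤
        Real.exp (-(s * (y - x))) * Real.exp (s * (y - x)) :=
      mul_le_mul_of_nonneg_right h (Real.exp_pos _).le
    rw [← Real.exp_add, neg_add_cancel, Real.exp_zero] at hmul
    linarith
  have h2 : (1 - s) * (y - x) + 1 ≤ Real.exp ((1 - s) * (y - x)) := Real.add_one_le_exp _
  -- `e^y - e^m ≤ s L e^y`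
  have hA : Real.exp y - Real.exp (s * x + (1 - s) * y) ≤ s * (y - x) * Real.exp y := by
    have := mul_le_mul_of_nonneg_left h1 (Real.exp_pos (s * x + (1 - s) * y)).le
    rw [hy]
    linarith
  -- `(1-s) L e^x ≤ e^m - e^x`
  have hB : (1 - s) * (y - x) * Real.exp x ≤ Real.exp (s * x + (1 - s) * y) - Real.exp x := by
    have := mul_le_mul_of_nonneg_left h2 (Real.exp_pos x).le
    rw [hm]
    linarith
  have hA' := mul_le_mul_of_nonneg_left hA h1s
  have hB' := mul_le_mul_of_nonneg_left hB hs0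
  linarith

/-- Two-point convexity of `u ↦ e^{-c u}`: `e^{-c (s a + (1-s) b)} ≤ s e^{-c a} + (1-s) e^{-c b}` for
`s ∈ [0,1]` (from `convexOn_exp`). -/
theorem exp_neg_mul_convexCombo_le (c a b : ℝ) {s : ℝ} (hs0 : 0 ≤ s) (hs1 : s ≤ 1) :
    Real.exp (-(c * (s * a + (1 - s) * b))) ≤
      s * Real.exp (-(c * a)) + (1 - s) * Real.exp (-(c * b)) := by
  have h := convexOn_exp.2 (Set.mem_univ (-(c * a))) (Set.mem_univ (-(c * b))) hs0
    (sub_nonneg.2 hs1) (by ring)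
  simp only [smul_eq_mul] at h
  have harg : s * -(c * a) + (1 - s) * -(c * b) = -(c * (s * a + (1 - s) * b)) := by ring
  rwa [harg] at h

/-! ## The Hurwitz–Lerch part is a convex mixture of exponentials -/

/-- Termwise: for `a, b ≥ 0`, `s ∈ [0,1]`, `t = s a + (1-s) b` and `k ∈ ℕ`,
`e^{-t/2} e^{-2tk}/(k+¼)² ≤ s · e^{-a/2} e^{-2ak}/(k+¼)² + (1-s) · e^{-b/2} e^{-2bk}/(k+¼)²`
(the function `u ↦ e^{-(2k+½)u}` is convex). -/
theorem hurwitzLerch_term_convexCombo (k : ℕ) {a b s : ℝ} (ha : 0 ≤ a) (hb : 0 ≤ b)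
    (hs0 : 0 ≤ s) (hs1 : s ≤ 1) :
    Real.exp (-((s * a + (1 - s) * b) / 2)) *
        (Real.exp (-(2 * |s * a + (1 - s) * b| * k)) / ((k : ℝ) + 1 / 4) ^ 2) ≤
      s * (Real.exp (-(a / 2)) * (Real.exp (-(2 * |a| * k)) / ((k : ℝ) + 1 / 4) ^ 2)) +
        (1 - s) * (Real.exp (-(b / 2)) * (Real.exp (-(2 * |b| * k)) / ((k : ℝ) + 1 / 4) ^ 2)) := by
  have h1s : 0 ≤ 1 - s := sub_nonneg.2 hs1
  have ht0 : 0 ≤ s * a + (1 - s) * b := by positivity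
  rw [abs_of_nonneg ht0, abs_of_nonneg ha, abs_of_nonneg hb]
  have hc : 0 < ((k : ℝ) + 1 / 4) ^ 2 := by positivity
  have key := exp_neg_mul_convexCombo_le (2 * k + 1 / 2) a b hs0 hs1
  have et : Real.exp (-((s * a + (1 - s) * b) / 2)) * Real.exp (-(2 * (s * a + (1 - s) * b) * k))
      = Real.exp (-((2 * k + 1 / 2) * (s * a + (1 - s) * b))) := by
    rw [← Real.exp_add]; congr 1; ring
  have ea : Real.exp (-(a / 2)) * Real.exp (-(2 * a * k)) = Real.exp (-((2 * k + 1 / 2) * a)) := by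
    rw [← Real.exp_add]; congr 1; ring
  have eb : Real.exp (-(b / 2)) * Real.exp (-(2 * b * k)) = Real.exp (-((2 * k + 1 / 2) * b)) := by
    rw [← Real.exp_add]; congr 1; ring
  calc Real.exp (-((s * a + (1 - s) * b) / 2)) *
        (Real.exp (-(2 * (s * a + (1 - s) * b) * k)) / ((k : ℝ) + 1 / 4) ^ 2)
      = Real.exp (-((2 * k + 1 / 2) * (s * a + (1 - s) * b))) / ((k : ℝ) + 1 / 4) ^ 2 := by
        rw [← mul_div_assoc, et]
    _ ≤ (s * Real.exp (-((2 * k + 1 / 2) * a)) + (1 - s) * Real.exp (-((2 * k + 1 / 2) * b))) /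
          ((k : ℝ) + 1 / 4) ^ 2 := div_le_div_of_nonneg_right key hc.le
    _ = s * (Real.exp (-(a / 2)) * (Real.exp (-(2 * a * k)) / ((k : ℝ) + 1 / 4) ^ 2)) +
          (1 - s) * (Real.exp (-(b / 2)) * (Real.exp (-(2 * b * k)) / ((k : ℝ) + 1 / 4) ^ 2)) := by
        rw [← ea, ← eb]; ring

/-- **The Hurwitz–Lerch part of `Ψ` is convex on `[0, ∞)`** (two-point form): for `a, b ≥ 0`,
`s ∈ [0,1]`, `t = s a + (1-s) b`,
`e^{-t/2} Φ(e^{-2t},2,¼) ≤ s · e^{-a/2} Φ(e^{-2a},2,¼) + (1-s) · e^{-b/2} Φ(e^{-2b},2,¼)`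
(`e^{-t/2} Φ(e^{-2t},2,¼) = ∑_k e^{-(2k+½)t}/(k+¼)²`, summed termwise with `hasSum_le`). -/
theorem exp_neg_mul_hurwitzLerchQuarter_convexCombo {a b s : ℝ} (ha : 0 ≤ a) (hb : 0 ≤ b)
    (hs0 : 0 ≤ s) (hs1 : s ≤ 1) :
    Real.exp (-((s * a + (1 - s) * b) / 2)) * hurwitzLerchQuarter (s * a + (1 - s) * b) ≤
      s * (Real.exp (-(a / 2)) * hurwitzLerchQuarter a) +
        (1 - s) * (Real.exp (-(b / 2)) * hurwitzLerchQuarter b) := by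
  have hL : HasSum (fun k : ℕ ↦ Real.exp (-((s * a + (1 - s) * b) / 2)) *
      (Real.exp (-(2 * |s * a + (1 - s) * b| * k)) / ((k : ℝ) + 1 / 4) ^ 2))
      (Real.exp (-((s * a + (1 - s) * b) / 2)) * hurwitzLerchQuarter (s * a + (1 - s) * b)) :=
    (summable_hurwitzLerchQuarter _).hasSum.mul_left _
  have hR : HasSum (fun k : ℕ ↦
      s * (Real.exp (-(a / 2)) * (Real.exp (-(2 * |a| * k)) / ((k : ℝ) + 1 / 4) ^ 2)) +
        (1 - s) * (Real.exp (-(b / 2)) * (Real.exp (-(2 * |b| * k)) / ((k : ℝ) + 1 / 4) ^ 2)))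
      (s * (Real.exp (-(a / 2)) * hurwitzLerchQuarter a) +
        (1 - s) * (Real.exp (-(b / 2)) * hurwitzLerchQuarter b)) :=
    (((summable_hurwitzLerchQuarter a).hasSum.mul_left _).mul_left _).add
      (((summable_hurwitzLerchQuarter b).hasSum.mul_left _).mul_left _)
  exact hasSum_le (fun k ↦ hurwitzLerch_term_convexCombo k ha hb hs0 hs1) hL hR

/-! ## The stub -/

/-- **Stub `stub_smoothPartQuarticDefect` (crux `SparseScrewLandau.QuarticSampleLandau`).** For every
`t ≥ 0` there is a quartic cell `[4 log n, 4 log (n+1)] ∋ t` (`n = ⌊e^{t/4}⌋ ≥ 1`,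
`t = s · 4 log n + (1-s) · 4 log (n+1)`, `s ∈ [0,1]`) on which the smooth part `G = Ψ + φ`
(`Ψ = zetaScrew`, `φ = zetaScrewPrimeSum`) lies above its chord minus `D = 8`:
`s G(4 log n) + (1-s) G(4 log (n+1)) - 8 ≤ G(t)`.  Archimedean chord defect `≤ 4·(3/2) + 4·(1/2)`
by `exp_chord_defect`; Hurwitz–Lerch part convex (`exp_neg_mul_hurwitzLerchQuarter_convexCombo`);
affine part exact. -/
theorem stub_smoothPartQuarticDefect :
    ∃ D : ℝ, ∀ t : ℝ, 0 ≤ t → ∃ n : ℕ, 1 ≤ n ∧ ∃ s : ℝ, 0 ≤ s ∧ s ≤ 1 ∧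
      t = s * (4 * Real.log n) + (1 - s) * (4 * Real.log ((n : ℝ) + 1)) ∧
      s * (zetaScrew (4 * Real.log n) + zetaScrewPrimeSum (4 * Real.log n)) +
          (1 - s) * (zetaScrew (4 * Real.log ((n : ℝ) + 1)) +
            zetaScrewPrimeSum (4 * Real.log ((n : ℝ) + 1)))
          - D ≤ zetaScrew t + zetaScrewPrimeSum t := by
  refine ⟨8, fun t ht ↦ ?_⟩
  -- locate the quartic cell of `t`: `n = ⌊e^{t/4}⌋`
  obtain ⟨n, hn1, hat, htb⟩ : ∃ n : ℕ, 1 ≤ n ∧ 4 * Real.log n ≤ t ∧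
      t < 4 * Real.log ((n : ℝ) + 1) := by
    have h1 : 1 ≤ ⌊Real.exp (t / 4)⌋₊ :=
      (Nat.one_le_floor_iff _).2 (Real.one_le_exp (by linarith))
    have hpos : (0 : ℝ) < (⌊Real.exp (t / 4)⌋₊ : ℕ) := by exact_mod_cast h1
    refine ⟨⌊Real.exp (t / 4)⌋₊, h1, ?_, ?_⟩
    · have h := Real.log_le_log hpos (Nat.floor_le (Real.exp_pos (t / 4)).le)
      rw [Real.log_exp] at h
      linarith
    · have h := Real.log_lt_log (Real.exp_pos (t / 4)) (Nat.lt_floor_add_one (Real.exp (t / 4)))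
      rw [Real.log_exp] at h
      linarith
  have hn0 : (0 : ℝ) < n := by exact_mod_cast hn1
  have hn1r : (1 : ℝ) ≤ n := by exact_mod_cast hn1
  have hn10 : (0 : ℝ) < (n : ℝ) + 1 := by linarith
  set a : ℝ := 4 * Real.log n with ha_def
  set b : ℝ := 4 * Real.log ((n : ℝ) + 1) with hb_def
  have ha0 : 0 ≤ a := by
    have := Real.log_nonneg hn1r
    rw [ha_def]; positivity
  have hab : a < b := by
    have := Real.log_lt_log hn0 (show (n : ℝ) < n + 1 by linarith)
    rw [ha_def, hb_def]; linarith
  have hb0 : 0 ≤ b := ha0.trans hab.le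
  have hba : 0 < b - a := sub_pos.2 hab
  -- barycentric coordinate of `t` in the cell
  set s : ℝ := (b - t) / (b - a) with hs_def
  have hs0 : 0 ≤ s := div_nonneg (by linarith) hba.le
  have hs1 : s ≤ 1 := (div_le_one hba).2 (by linarith)
  have hts : t = s * a + (1 - s) * b := by
    rw [hs_def]; field_simp; ring
  clear_value s
  refine ⟨n, hn1, s, hs0, hs1, hts, ?_⟩
  have h1s : 0 ≤ 1 - s := sub_nonneg.2 hs1
  have ht0 : 0 ≤ s * a + (1 - s) * b := by positivity
  -- cell geometry: `e^{a/2} = n²`, `e^{b/2} = (n+1)²`, `(b/2 - a/2)·n ≤ 2`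
  have hea : Real.exp (a / 2) = (n : ℝ) ^ 2 := by
    rw [show a / 2 = Real.log n + Real.log n by rw [ha_def]; ring, Real.exp_add, Real.exp_log hn0]
    ring
  have heb : Real.exp (b / 2) = ((n : ℝ) + 1) ^ 2 := by
    rw [show b / 2 = Real.log ((n : ℝ) + 1) + Real.log ((n : ℝ) + 1) by rw [hb_def]; ring,
      Real.exp_add, Real.exp_log hn10]
    ring
  have hlog : Real.log ((n : ℝ) + 1) - Real.log n ≤ 1 / n := by
    rw [← Real.log_div hn10.ne' hn0.ne']
    have h := Real.log_le_sub_one_of_pos (show (0 : ℝ) < ((n : ℝ) + 1) / n by positivity)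
    have h' : ((n : ℝ) + 1) / n - 1 = 1 / n := by
      field_simp
      ring
    linarith
  have hX0 : 0 ≤ b / 2 - a / 2 := by linarith
  have hXn : (b / 2 - a / 2) * n ≤ 2 := by
    calc (b / 2 - a / 2) * n = 2 * (Real.log ((n : ℝ) + 1) - Real.log n) * n := by
          rw [ha_def, hb_def]; ring
      _ ≤ 2 * (1 / n) * n := by gcongr
      _ = 2 := by field_simp
  have hX2 : b / 2 - a / 2 ≤ 2 := by nlinarith
  have hS : s * (1 - s) ≤ 1 / 4 := by nlinarith [sq_nonneg (2 * s - 1)]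
  have hS0 : 0 ≤ s * (1 - s) := mul_nonneg hs0 h1s
  -- (1) the convex piece `4 e^{t/2}`: chord defect ≤ 3/2 (before the factor 4)
  have h1 := exp_chord_defect (a / 2) (b / 2) hs0 hs1
  rw [show s * (a / 2) + (1 - s) * (b / 2) = (s * a + (1 - s) * b) / 2 by ring] at h1
  have h1b : s * (1 - s) * (b / 2 - a / 2) * (Real.exp (b / 2) - Real.exp (a / 2)) ≤ 3 / 2 := by
    rw [hea, heb]
    have hY : ((n : ℝ) + 1) ^ 2 - (n : ℝ) ^ 2 = 2 * n + 1 := by ring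
    rw [hY]
    have hXY : (b / 2 - a / 2) * (2 * n + 1) ≤ 6 := by nlinarith
    calc s * (1 - s) * (b / 2 - a / 2) * (2 * n + 1)
        = (s * (1 - s)) * ((b / 2 - a / 2) * (2 * n + 1)) := by ring
      _ ≤ (1 / 4) * 6 := mul_le_mul hS hXY (mul_nonneg hX0 (by positivity)) (by norm_num)
      _ = 3 / 2 := by norm_num
  -- (2) the convex piece `4 e^{-t/2}`: chord defect ≤ 1/2 (before the factor 4)
  have h2 := exp_chord_defect (-(b / 2)) (-(a / 2)) (s := 1 - s) h1s (by linarith)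
  rw [show (1 - s) * -(b / 2) + (1 - (1 - s)) * -(a / 2) = -((s * a + (1 - s) * b) / 2) by ring]
    at h2
  have h2b : (1 - s) * (1 - (1 - s)) * (-(a / 2) - -(b / 2)) *
      (Real.exp (-(a / 2)) - Real.exp (-(b / 2))) ≤ 1 / 2 := by
    have hZ0 : 0 ≤ Real.exp (-(a / 2)) - Real.exp (-(b / 2)) := by
      have := Real.exp_le_exp.2 (show -(b / 2) ≤ -(a / 2) by linarith)
      linarith
    have hZ1 : Real.exp (-(a / 2)) - Real.exp (-(b / 2)) ≤ 1 := by
      have h1' : Real.exp (-(a / 2)) ≤ 1 := Real.exp_le_one_iff.2 (by linarith)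
      have h2' := Real.exp_pos (-(b / 2))
      linarith
    have hXZ : (b / 2 - a / 2) * (Real.exp (-(a / 2)) - Real.exp (-(b / 2))) ≤ 2 := by
      nlinarith
    calc (1 - s) * (1 - (1 - s)) * (-(a / 2) - -(b / 2)) * (Real.exp (-(a / 2)) - Real.exp (-(b / 2)))
        = (s * (1 - s)) * ((b / 2 - a / 2) * (Real.exp (-(a / 2)) - Real.exp (-(b / 2)))) := by ring
      _ ≤ (1 / 4) * 2 := mul_le_mul hS hXZ (mul_nonneg hX0 hZ0) (by norm_num)
      _ = 1 / 2 := by norm_num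
  -- (3) the Hurwitz–Lerch part is convex
  have h3 := exp_neg_mul_hurwitzLerchQuarter_convexCombo ha0 hb0 hs0 hs1
  -- assemble: unfold `Ψ` by (1.1); the prime sums cancel, the affine part is exact
  rw [hts, zetaScrew_eq a, zetaScrew_eq b, zetaScrew_eq (s * a + (1 - s) * b), abs_of_nonneg ha0,
    abs_of_nonneg hb0, abs_of_nonneg ht0]
  linarith [h1, h1b, h2, h2b, h3]

end Summit.RiemannHypothesis.RiemannHypothesis.Theorems.SparseScrewLandau

end
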